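import Mathlib.MeasureTheory.Integral.Bochner.Set
import Mathlib.MeasureTheory.Group.Measure
import Mathlib.Topology.Algebra.Group.Quotient
import HarnessLib

/-!
# Integration over unions of left cosets of an open subgroup

Topic `NumberTheory/Automorphic` (harmonic analysis on a locally compact group `G` with an open
subgroup `K`, the setting of Hecke operators); theorems only, Mathlib measure theory only.

For a group `G` with a left-invariant measure `μ`, an open subgroup `K` of finite measure, and a
function `F : G → E` which is **right-`K`-invariant** (`F (x k) = F x`, `k ∈ K`):

* `setOf_mk_eq_eq_smul`: the fibre of `G → G ⧸ K` over `γ` is the left coset `γ.out • K`; fibres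
  are disjoint (`disjoint_setOf_mk_eq`), open and measurable (`isOpen_setOf_mk_eq`,
  `measurableSet_setOf_mk_eq`) of measure `μ(K)` (`measure_setOf_mk_eq`); `F` is constant on
  each fibre (`apply_eq_apply_out_of_mk_eq`);
* `setIntegral_setOf_mk_eq`: `∫_{γ} F dμ = μ(K) • F(γ.out)` with integrability;
* `integral_setOf_mk_mem_eq_tsum` (**unfolding**): for a countable set `T ⊆ G ⧸ K` of cosets with
  `∑_{γ ∈ T} ‖F(γ.out)‖ < ∞`, `F` is integrable on `S = {x : xK ∈ T}` and
  `∫_S F dμ = μ(K) • ∑_{γ ∈ T} F(γ.out)`.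

This is the routine passage from `p`-adic integrals to sums over `K`-cosets — e.g. Hecke
operators as convolution integrals (`heckeOperator_apply_eq_integral` of `HeckeAlgebra`), or the
unramified computation of local zeta integrals (Godement–Jacquet (1972), Lemma 6.10), its first
consumer (`GodementJacquetLemma610Bounded`). Mathlib has the ingredients (`measure_smul`,
`integral_iUnion`, `integrableOn_iUnion_of_summable_integral_norm`) but no such packaged
statement (`lean search` for `integral.*coset`, `tsum.*QuotientGroup`: nothing relevant).

## References

* D. Bump, *Automorphic Forms and Representations* (1997), §4.6 (the spherical Hecke algebra as
  compactly supported bi-`K`-invariant functions under convolution, i.e. integrals over unions of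
  `K`-cosets) [Bump1997].
-/

noncomputable section

open MeasureTheory Function
open scoped Pointwise

namespace Literature.NumberTheory.Automorphic

section Algebra

variable {G : Type*} [Group G] (K : Subgroup G)

/-- The fibre of `G → G ⧸ K` over `γ` is the left coset `γ.out • K`. [folklore] -/
theorem setOf_mk_eq_eq_smul (γ : G ⧸ K) :
    {x : G | (x : G ⧸ K) = γ} = γ.out • (K : Set G) := by
  ext x
  rw [Set.mem_setOf_eq, mem_leftCoset_iff, SetLike.mem_coe]
  conv_lhs => rw [← QuotientGroup.out_eq' γ, eq_comm, QuotientGroup.eq]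

/-- Fibres of `G → G ⧸ K` over distinct points are disjoint. [folklore] -/
theorem disjoint_setOf_mk_eq {γ γ' : G ⧸ K} (h : γ ≠ γ') :
    Disjoint {x : G | (x : G ⧸ K) = γ} {x : G | (x : G ⧸ K) = γ'} := by
  rw [Set.disjoint_left]
  intro x hx hx'
  exact h (hx.symm.trans hx')

/-- A right-`K`-invariant function is constant on each left coset: `F x = F γ.out` on the fibre
over `γ`. [folklore] -/
theorem apply_eq_apply_out_of_mk_eq {E : Type*} {F : G → E}
    (hF : ∀ x : G, ∀ k ∈ K, F (x * k) = F x) {x : G} {γ : G ⧸ K} (hx : (x : G ⧸ K) = γ) :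
    F x = F γ.out := by
  have h : γ.out⁻¹ * x ∈ K := by
    rw [← QuotientGroup.eq, QuotientGroup.out_eq', hx]
  have := hF γ.out (γ.out⁻¹ * x) h
  rwa [mul_inv_cancel_left] at this

end Algebra

section CosetIntegral

variable {G : Type*} [Group G] [TopologicalSpace G] [IsTopologicalGroup G] [MeasurableSpace G]
  [BorelSpace G] {K : Subgroup G}

omit [MeasurableSpace G] [BorelSpace G] in
/-- A left coset of an open subgroup is open. [folklore] -/
theorem isOpen_setOf_mk_eq (hK : IsOpen (K : Set G)) (γ : G ⧸ K) :
    IsOpen {x : G | (x : G ⧸ K) = γ} := by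
  rw [setOf_mk_eq_eq_smul]
  exact hK.smul _

/-- A left coset of an open subgroup is measurable. [folklore] -/
theorem measurableSet_setOf_mk_eq (hK : IsOpen (K : Set G)) (γ : G ⧸ K) :
    MeasurableSet {x : G | (x : G ⧸ K) = γ} :=
  (isOpen_setOf_mk_eq hK γ).measurableSet

variable (K) in
omit [TopologicalSpace G] [IsTopologicalGroup G] [BorelSpace G] in
/-- All left cosets have the measure of `K` (left invariance). [folklore] -/
theorem measure_setOf_mk_eq (μ : Measure G) [μ.IsMulLeftInvariant] (γ : G ⧸ K) :
    μ {x : G | (x : G ⧸ K) = γ} = μ K := by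
  rw [setOf_mk_eq_eq_smul, measure_smul]

variable {E : Type*} [NormedAddCommGroup E] [NormedSpace ℝ E] [CompleteSpace E]
  {μ : Measure G} [μ.IsMulLeftInvariant]

/-- **The integral of a right-`K`-invariant function over one coset**: `∫_{γ} F = μ(K) • F(γ.out)`,
and `F` is integrable there (`K` open of finite measure). [folklore] -/
theorem setIntegral_setOf_mk_eq (hK : IsOpen (K : Set G)) (hμK : μ K < ⊤) {F : G → E}
    (hF : ∀ x : G, ∀ k ∈ K, F (x * k) = F x) (γ : G ⧸ K) :
    IntegrableOn F {x : G | (x : G ⧸ K) = γ} μ ∧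
      ∫ x in {x : G | (x : G ⧸ K) = γ}, F x ∂μ = (μ K).toReal • F γ.out := by
  have hconst : Set.EqOn F (fun _ => F γ.out) {x : G | (x : G ⧸ K) = γ} := fun x hx =>
    apply_eq_apply_out_of_mk_eq K hF hx
  have hfin : μ {x : G | (x : G ⧸ K) = γ} < ⊤ := by rw [measure_setOf_mk_eq]; exact hμK
  constructor
  · exact (integrableOn_const (hs := hfin.ne)).congr_fun hconst.symm (measurableSet_setOf_mk_eq hK γ)
  · rw [setIntegral_congr_fun (measurableSet_setOf_mk_eq hK γ) hconst, setIntegral_const,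
      Measure.real, measure_setOf_mk_eq]

/-- **Unfolding an integral over a union of left cosets into a sum over the cosets.** Let `K` be an
open subgroup of finite (left Haar) measure, `T ⊆ G ⧸ K` a countable set of cosets and `F` a
right-`K`-invariant function with `∑_{γ ∈ T} ‖F(γ.out)‖ < ∞`. Then `F` is integrable on the union
`S = {x : x K ∈ T}` of these cosets and `∫_S F dμ = μ(K) • ∑_{γ ∈ T} F(γ.out)` — the passage
from `p`-adic integrals to sums over `K`-cosets (Hecke operators as integrals, cf.
`heckeOperator_apply_eq_integral`; the unramified computation of zeta integrals). [folklore] -/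
theorem integral_setOf_mk_mem_eq_tsum (hK : IsOpen (K : Set G)) (hμK : μ K < ⊤) {F : G → E}
    (hF : ∀ x : G, ∀ k ∈ K, F (x * k) = F x) {T : Set (G ⧸ K)} (hT : T.Countable)
    (hsum : Summable fun γ : T => ‖F γ.1.out‖) :
    IntegrableOn F {x : G | (x : G ⧸ K) ∈ T} μ ∧
      ∫ x in {x : G | (x : G ⧸ K) ∈ T}, F x ∂μ = (μ K).toReal • ∑' γ : T, F γ.1.out := by
  haveI : Countable T := hT.to_subtype
  have hS : {x : G | (x : G ⧸ K) ∈ T} = ⋃ γ : T, {x : G | (x : G ⧸ K) = γ.1} := by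
    ext x
    simp only [Set.mem_setOf_eq, Set.mem_iUnion]
    exact ⟨fun h => ⟨⟨_, h⟩, rfl⟩, fun ⟨γ, hγ⟩ => hγ ▸ γ.2⟩
  have hm : ∀ γ : T, MeasurableSet {x : G | (x : G ⧸ K) = γ.1} := fun γ =>
    measurableSet_setOf_mk_eq hK γ.1
  have hd : Pairwise (Disjoint on fun γ : T => {x : G | (x : G ⧸ K) = γ.1}) := fun γ γ' h =>
    disjoint_setOf_mk_eq K fun e => h (Subtype.ext e)
  -- integrability on the union from the summability of the coset integrals of `‖F‖`
  have hnorm : ∀ x : G, ∀ k ∈ K, ‖F (x * k)‖ = ‖F x‖ := fun x k hk => by rw [hF x k hk]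
  have hint : IntegrableOn F (⋃ γ : T, {x : G | (x : G ⧸ K) = γ.1}) μ := by
    refine integrableOn_iUnion_of_summable_integral_norm
      (fun γ => (setIntegral_setOf_mk_eq hK hμK hF γ.1).1) ?_
    simp_rw [(setIntegral_setOf_mk_eq hK hμK (F := fun x => ‖F x‖) hnorm _).2, smul_eq_mul]
    exact hsum.mul_left _
  rw [hS]
  refine ⟨hint, ?_⟩
  rw [integral_iUnion hm hd hint]
  simp_rw [(setIntegral_setOf_mk_eq hK hμK hF _).2]
  exact tsum_const_smul'' _

end CosetIntegral

end Literature.NumberTheory.Automorphic
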